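/-
Copyright (c) 2026 the pub-hodgecm-mathlib formalisation cell (harness21).  Prover seat hodgecm-mathlib-A-p12 (g22), 2026-09-01.  «S3-ram» seeding wave (LEAD F0P3a-plan (g12)
T11-41∕T11-45, owner F0P3a-p06 (g15) table S3RAM-ORGANS row «C∕D-entry»): the PLACE-GENERIC twin of ★ p842297 `UnitaryTypeTwoNormPairCentralizerCompact` (there: `v` unramified,
`2 ∈ 𝒪_w^×`, `χ` integral, `|disc| = q^{−(2N+1)}`; here: any non-split `v`, in particular tame-RAMIFIED).
-/
import Literature.NumberTheory.Automorphic.UnitaryRankTwoCentralizerCompactness       -- ★ B-p04 (g34): `compactSpace_centralizer_cmDatum_two_of_not_exists_isRoot` (rank 2, ANY non-split place, no parity)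
import Literature.NumberTheory.Automorphic.UnitaryTypeTwoNormPairCentralizerCompact    -- ★ p842297 B-p10 (g25): `compactSpace_centralizer_of_compactSpace` (+ the inert organ this file generalises)
import HarnessLib

/-!
# The centraliser of a `G′`-element matching a TYPE-(2) `H`-class is COMPACT at EVERY non-split place — ramified places included
(Rogawski (1990) §3.6, §4.3; Platonov–Rapinchuk §3.3)

Topic `NumberTheory/Automorphic`; namespace `Literature.NumberTheory.Automorphic.UnitaryGroup`.  THEOREMS ONLY (no definition, no instance, no notation, no named fact, no
`sorry`); kernel lane `--supports stmt-HodgeConjecture-24833`; count-neutral.  Cell `pub/hodgecm-mathlib`, crux H413; «S3-ram» SEEDING WAVE (tame-ramified non-split `v ∤ 2`), row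
«C∕D-entry» of `S3RAM-ORGANS.md` (owner F0P3a-p06 (g15)): the ramified twin of the inert ★ organ `compactSpace_centralizer_of_isLocalNormPair_of_not_exists_isRoot` (★ p842297,
binders `hunr`, `h2`, `hint`, `hN : |tr² − 4 det|_w = q^{−(2N+1)}`).  CENSUS-BY-NAME FINDING: the rank-2 elliptic-torus compactness is ALREADY ★ place-generically — B-p04 (g34)
`compactSpace_centralizer_cmDatum_two_of_not_exists_isRoot` (only hypothesis: `χ_{γ₂,w}` has no root in `L_w`; coercivity of the anisotropic norm form replaces the odd-discriminant
argument) — so the ramified twin is a forty-line CITATION: `Z_{H_v}(γ_H) = Z(γ₂) × Z(γ₁)` with `U(Φ₁)(L⁺_v) = L_w¹` compact (★ `compactSpace_cmDatum_local_one_of_smul_eq`), and the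
endoscopic torus isomorphism ★ `exists_localEndoCentralizerEquiv` carries it onto `Z_{G′_v}(δ)`.  The statements below are those of ★ p842297 with the binders `hunr h2 hint N hN`
DELETED (strictly more general: valid at inert, tame-ramified and wildly ramified non-split `v` alike); the inert ★ organ is the special case.
HONEST LABEL: HC_CM is proved only modulo the 2 remaining named inputs (hLiu418 24832, h413 24833) until rung 0 closes; this file is unconditional topology.

* (`det Φ₂ ≠ 0` is ★ `Rogawski1990.det_antidiagTwo_ne_zero`; re-derived inline to keep the imports light.)
* `compactSpace_centralizer_endoPair_of_not_exists_isRoot_nonsplit` — `CompactSpace Z_{H_v}(γ_H)` for type-(2) `γ_H`, any non-split `v`.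
* **`compactSpace_centralizer_of_isLocalNormPair_of_not_exists_isRoot_nonsplit`** — `CompactSpace Z_{G′_v}(δ)` for `γ_H → δ`, `γ_H` `G`-regular of type (2), any non-split `v`.

## References
* [Rogawski1990] J. D. Rogawski, *Automorphic Representations of Unitary Groups in Three Variables*, Ann. of Math. Stud. 123 (1990): §3.6 pp. 31–32, §4.3 pp. 42–44.
* [PlatonovRapinchuk1994] V. Platonov, A. Rapinchuk, *Algebraic Groups and Number Theory* (1994): §3.1 Thm. 3.1, §3.3 (anisotropic tori over local fields are compact).
* [Flicker1998UnitaryFL] Y. Z. Flicker, *Elementary proof of the fundamental lemma for a unitary group*, Canad. J. Math. 50 (1998): §6 p. 97 (the torus `(EL)¹ × E¹`).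
-/

set_option autoImplicit false

noncomputable section

open NumberField IsDedekindDomain Matrix Topology
open scoped Matrix MatrixGroups

namespace Literature.NumberTheory.Automorphic.UnitaryGroup

open Literature.NumberTheory.Rogawski1990

variable (L : Type) [Field L] [NumberField L] [IsCMField L] (v : HeightOneSpectrum (𝓞 ↥(maximalRealSubfield L)))
  (w : PlacesOver L v) (hw : IsCMField.complexConj L • w.1 = w.1)

include hw in
/-- **`Z_{H_v}(γ_H)` IS COMPACT for a type-(2) `γ_H = (γ₂, γ₁)` at ANY non-split `v`** (`χ_{γ₂,w}` without root in `L_w`; no ramification, parity, integrality or `|2|`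
hypothesis): `Z(γ_H) = Z_{U(Φ₂)}(γ₂) × Z_{U(Φ₁)}(γ₁)` with ★ `compactSpace_centralizer_cmDatum_two_of_not_exists_isRoot` for the first factor and `U(Φ₁)(L⁺_v) = L_w¹` compact
for the second. [cite: Rogawski1990, §3.6 pp. 31–32] [cite: PlatonovRapinchuk1994, §3.3] [cite: Flicker1998UnitaryFL, §6 p. 97] -/
theorem compactSpace_centralizer_endoPair_of_not_exists_isRoot_nonsplit
    (γH : (cmDatum L 2 (Matrix.of fun i j : Fin 2 => if i.val + j.val + 1 = 2 then (1 : L) else 0)).Local v ×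
      (cmDatum L 1 (Matrix.of fun i j : Fin 1 => if i.val + j.val + 1 = 1 then (1 : L) else 0)).Local v)
    (hirr : ¬ ∃ x : (w.1.adicCompletion L), ((((γH.1.val : GL (Fin 2) (LocalRing L v)).val.map
      (Pi.evalRingHom (fun w' : PlacesOver L v => w'.1.adicCompletion L) w))).charpoly).IsRoot x) :
    CompactSpace ↥(Subgroup.centralizer ({γH} : Set ((cmDatum L 2 (Matrix.of fun i j : Fin 2 => if i.val + j.val + 1 = 2 then (1 : L) else 0)).Local v ×
      (cmDatum L 1 (Matrix.of fun i j : Fin 1 => if i.val + j.val + 1 = 1 then (1 : L) else 0)).Local v))) := by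
  have hΦ₂ : (Matrix.of fun i j : Fin 2 => if i.val + j.val + 1 = 2 then (1 : L) else 0).det ≠ 0 := by
    rw [Matrix.det_fin_two]; simp
  haveI := compactSpace_centralizer_cmDatum_two_of_not_exists_isRoot L v w hw hΦ₂ γH.1 hirr
  haveI : CompactSpace ((cmDatum L 1 (Matrix.of fun i j : Fin 1 => if i.val + j.val + 1 = 1 then (1 : L) else 0)).Local v) :=
    compactSpace_cmDatum_local_one_of_smul_eq L (Matrix.of fun i j : Fin 1 => if i.val + j.val + 1 = 1 then (1 : L) else 0) w hw
      (isUnit_placeForm_antidiagOne (E := L) 1 w.1)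
  haveI : CompactSpace ↥(Subgroup.centralizer ({γH.2} : Set ((cmDatum L 1 (Matrix.of fun i j : Fin 1 => if i.val + j.val + 1 = 1 then (1 : L) else 0)).Local v))) :=
    compactSpace_centralizer_of_compactSpace γH.2
  have h := compactSpace_centralizer_prod γH.1 γH.2
  rwa [Prod.mk.eta] at h

include hw in
/-- **`Z_{G′_v}(δ)` IS COMPACT for `δ ∈ U(H′)(L⁺_v)` matching a `G`-regular type-(2) `γ_H`, at ANY non-split `v`** (`IsLocalNormPair L H' v γH δ`; ramified places
included — the «S3-ram» twin of ★ p842297 with `hunr h2 hint N hN` deleted).  The endoscopic torus isomorphism ★ `exists_localEndoCentralizerEquiv` carries the compact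
`Z_{H_v}(γ_H)` onto `Z_{G′_v}(δ)`. [cite: Rogawski1990, §4.3 pp. 42–44, §3.6 pp. 31–32] [cite: PlatonovRapinchuk1994, §3.1 Thm. 3.1] -/
theorem compactSpace_centralizer_of_isLocalNormPair_of_not_exists_isRoot_nonsplit {H' : Matrix (Fin 3) (Fin 3) L} (hH'u : IsUnit H')
    {γH : (cmDatum L 2 (Matrix.of fun i j : Fin 2 => if i.val + j.val + 1 = 2 then (1 : L) else 0)).Local v ×
      (cmDatum L 1 (Matrix.of fun i j : Fin 1 => if i.val + j.val + 1 = 1 then (1 : L) else 0)).Local v}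
    (hreg : IsLocalGRegular L v γH)
    (hirr : ¬ ∃ x : (w.1.adicCompletion L), ((((γH.1.val : GL (Fin 2) (LocalRing L v)).val.map
      (Pi.evalRingHom (fun w' : PlacesOver L v => w'.1.adicCompletion L) w))).charpoly).IsRoot x)
    (δ : (cmDatum L 3 H').Local v) (hm : IsLocalNormPair L H' v γH δ) :
    CompactSpace ↥(Subgroup.centralizer ({δ} : Set ((cmDatum L 3 H').Local v))) := by
  haveI := compactSpace_centralizer_endoPair_of_not_exists_isRoot_nonsplit L v w hw γH hirr
  have hdet : H'.det ≠ 0 := ((Matrix.isUnit_iff_isUnit_det H').1 hH'u).ne_zero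
  obtain ⟨e, -⟩ := exists_localEndoCentralizerEquiv L v hdet hreg hm
  exact e.toHomeomorph.compactSpace

end Literature.NumberTheory.Automorphic.UnitaryGroup

end
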